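import Summits.QuantumAdvantage.QuantumAdvantage.Theorems.WbwObfuscatedGluedTreesKowRiVocabulary
import Summits.QuantumAdvantage.QuantumAdvantage.Theorems.WbwObfuscatedGluedTreesKowBbNamingTables
import Summits.QuantumAdvantage.QuantumAdvantage.Theorems.WbwObfuscatedGluedTreesKowBbFibre

/-!
# Stub `stub_namingCode` — the naming layer of ideal model II is EXACTLY stage 5's ideal naming
# (crux `WbwObfuscatedGluedTrees`, stmt-QuantumAdvantage-2340; line `knowledge-of-walk-split`, stage 6,
# the real→ideal statistical layer)

Registered stub of the stage-6 skeleton (target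
`…Cruxes.WbwObfuscatedGluedTrees.KnowledgeOfWalkSplit.RealIdeal.IdealCodeSoundness`), over the stage-6 vocabulary
`Theorems/WbwObfuscatedGluedTreesKowRiVocabulary.lean` (§1 the table scheme `tabScheme`, the code naming
`codeNaming`; §5 the tag / mask tables `tagT`, `maskT`).

* (i) For EVERY `μ, d` and every table quadruple `H`, the code naming `codeNaming H d` — the generator's own `naming`
  run over the table scheme `tabScheme H` with the naming keys `tkey 0`, `tkey 1` — IS stage 5's ideal SIV naming
  `sivNaming (tagT H.1.1 d) (maskT H.1.2 d)`: stage 5's `stub_namingTables` identifies `naming P μ k₁ k₂ d` with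
  `sivNaming (tagTableOf P μ k₁ d) (maskTableOf P μ k₂ d)` for every scheme `P`, and at the table scheme these two
  tables are `tagT H.1.1 d` (a listed `μ`-bit vector is fixed by `fit μ`) and `maskT H.1.2 d` (`prf_tabScheme`,
  `vecOf_ofFn`, `ofFn_vecOf`).
* (ii) For `2d + 3 ≤ μ` the map `(H₀, H₁) ↦ (tagT H₀ d, maskT H₁ d)` from naming pairs to (tag table, mask table)
  has ALL FIBRES OF ONE SIZE: `tagT H₀ d = T` prescribes the values of `H₀` on the zero-padded labels, an INJECTIVE
  family since `2d + 3 ≤ μ` (`card_fun_prescribed` of stage 5), and `maskT H₁ d = Mk` prescribes, independently for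
  every `τ`, the first `2d + 3` coordinates of `H₁ τ` (`card_fun_prescribed` along `Fin.castLE` for each `τ`,
  `Fintype.card_pi`).  Summing over the fibres (`Finset.card_eq_sum_card_fiberwise`) every event of the tables is
  counted proportionally through the naming pairs; the registered form is the cross-multiplied identity (no
  division).
-/

set_option linter.dupNamespace false

namespace Summit.QuantumAdvantage.QuantumAdvantage.Theorems.WbwObfuscatedGluedTrees.KnowledgeOfWalk.RealIdeal

open Literature.Computability.Complexity Literature.Computability.QuantumComplexity
open Literature.Computability.QuantumComplexity.GluedTrees
open Literature.Computability.Cryptography Literature.Computability.Cryptography.ObfuscatedGluedTrees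
open Summit.QuantumAdvantage.QuantumAdvantage.Theorems.WbwObfuscatedGluedTrees.KnowledgeOfWalk.BlackBox

variable {d μ : ℕ}

/-! ## (i) The code naming is the ideal SIV naming of the tag and mask tables -/

/-- At the table scheme, the tag table of the key `tkey 0` is the tag table `tagT` of the first naming table
(a listed `μ`-bit vector is fixed by `fit μ`). [folklore] -/
theorem tagTableOf_tabScheme (H : CodeSpace μ) (d : ℕ) :
    tagTableOf (tabScheme H) μ (tkey 0) d = tagT H.1.1 d := by
  funext ℓ
  apply List.ofFn_injective
  rw [ofFn_tagTableOf, prf_tabScheme, CodeSpace.tab_zero, fit_of_length_eq List.length_ofFn]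
  rfl

/-- At the table scheme, the mask table of the key `tkey 1` is the mask table `maskT` of the second naming table.
[folklore] -/
theorem maskTableOf_tabScheme (H : CodeSpace μ) (d : ℕ) :
    maskTableOf (tabScheme H) μ (tkey 1) d = maskT H.1.2 d := by
  funext τ
  apply List.ofFn_injective
  rw [ofFn_maskTableOf, prf_tabScheme, CodeSpace.tab_one, vecOf_ofFn]
  exact (ofFn_vecOf _ _).symm

/-- **(i) The code naming is the ideal SIV naming of its tables**:
`codeNaming H d = sivNaming (tagT H.1.1 d) (maskT H.1.2 d)` for all `μ`, `d`, `H` (stage 5's `stub_namingTables` at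
the table scheme). [folklore] -/
theorem codeNaming_eq_sivNaming (H : CodeSpace μ) (d : ℕ) :
    codeNaming H d = sivNaming (tagT H.1.1 d) (maskT H.1.2 d) := by
  rw [codeNaming, stub_namingTables, tagTableOf_tabScheme, maskTableOf_tabScheme]

/-! ## (ii) The fibres of `(H₀, H₁) ↦ (tagT H₀ d, maskT H₁ d)` -/

/-- Reading the first `L ≤ μ` coordinates of a listed `μ`-bit vector is the coordinate restriction along
`Fin.castLE`. [folklore] -/
theorem vecOf_ofFn_castLE {L μ : ℕ} (h : L ≤ μ) (v : Fin μ → Bool) :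
    vecOf L (List.ofFn v) = fun j => v (Fin.castLE h j) := by
  funext j
  have hj : (j : ℕ) < μ := lt_of_lt_of_le j.isLt h
  simp only [vecOf, List.getD_eq_getElem?_getD, List.getElem?_ofFn, hj, dite_true, Option.getD_some]
  rfl

/-- Zero-padding a short vector to `μ` bits and reading back its first coordinates gives it back. [folklore] -/
theorem vecOf_ofFn_pad {L μ : ℕ} (h : L ≤ μ) (ℓ : Fin L → Bool) :
    vecOf L (List.ofFn (vecOf μ (List.ofFn ℓ))) = ℓ := by
  rw [ofFn_vecOf, vecOf_fit h, vecOf_ofFn]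

/-- Zero-padding `{0,1}^L → {0,1}^μ` (`L ≤ μ`) is injective. [folklore] -/
theorem pad_injective {L μ : ℕ} (h : L ≤ μ) :
    Function.Injective fun ℓ : Fin L → Bool => vecOf μ (List.ofFn ℓ) :=
  Function.LeftInverse.injective (g := fun v => vecOf L (List.ofFn v)) (vecOf_ofFn_pad h)

/-- **The tag-table fibre.** The naming tables `H₀` with `tagT H₀ d = T` are the functions with the prescribed values
`T` on the injective family of zero-padded labels; their number does not depend on `T`. [folklore] -/
theorem card_fibre_tagT (h : labelLen d ≤ μ) (T : TagTable d μ) [Fintype {H₀ : PrfTable μ // tagT H₀ d = T}] :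
    Fintype.card {H₀ : PrfTable μ // tagT H₀ d = T} =
      Fintype.card (Fin μ → Bool) ^ (Fintype.card (Fin μ → Bool) - Fintype.card (Fin (labelLen d) → Bool)) := by
  classical
  rw [← card_fun_prescribed (fun ℓ : Fin (labelLen d) → Bool => vecOf μ (List.ofFn ℓ)) (pad_injective h) T]
  exact Fintype.card_congr (Equiv.subtypeEquivRight fun H₀ => funext_iff)

/-- One coordinate fibre of the mask table: the `μ`-bit vectors with prescribed first `2d + 3` coordinates are the
functions `Fin μ → Bool` with prescribed values along `Fin.castLE`; their number does not depend on the prescribed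
values. [folklore] -/
theorem card_fibre_trunc (h : labelLen d ≤ μ) (w : Fin (labelLen d) → Bool)
    [Fintype {v : Fin μ → Bool // vecOf (labelLen d) (List.ofFn v) = w}] :
    Fintype.card {v : Fin μ → Bool // vecOf (labelLen d) (List.ofFn v) = w} =
      Fintype.card Bool ^ (Fintype.card (Fin μ) - Fintype.card (Fin (labelLen d))) := by
  classical
  rw [← card_fun_prescribed (Fin.castLE h) (Fin.castLE_injective h) w]
  exact Fintype.card_congr (Equiv.subtypeEquivRight fun v => by rw [vecOf_ofFn_castLE h, funext_iff])

/-- **The mask-table fibre.** The naming tables `H₁` with `maskT H₁ d = Mk` are the families, indexed by the tags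
`τ`, of `μ`-bit vectors with prescribed first `2d + 3` coordinates `Mk τ`; their number does not depend on `Mk`.
[folklore] -/
theorem card_fibre_maskT (h : labelLen d ≤ μ) (Mk : MaskTable d μ) [Fintype {H₁ : PrfTable μ // maskT H₁ d = Mk}] :
    Fintype.card {H₁ : PrfTable μ // maskT H₁ d = Mk} =
      (Fintype.card Bool ^ (Fintype.card (Fin μ) - Fintype.card (Fin (labelLen d)))) ^
        Fintype.card (Fin μ → Bool) := by
  classical
  calc Fintype.card {H₁ : PrfTable μ // maskT H₁ d = Mk}
      = Fintype.card {H₁ : PrfTable μ // ∀ τ, vecOf (labelLen d) (List.ofFn (H₁ τ)) = Mk τ} :=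
        Fintype.card_congr (Equiv.subtypeEquivRight fun H₁ => funext_iff)
    _ = Fintype.card (∀ τ : Fin μ → Bool, {v : Fin μ → Bool // vecOf (labelLen d) (List.ofFn v) = Mk τ}) :=
        Fintype.card_congr (Equiv.subtypePiEquivPi (p := fun τ v => vecOf (labelLen d) (List.ofFn v) = Mk τ))
    _ = _ := by
        rw [Fintype.card_pi, Finset.prod_congr rfl fun τ _ => card_fibre_trunc h (Mk τ), Finset.prod_const,
          Finset.card_univ]

/-- **All fibres of `(H₀, H₁) ↦ (tagT H₀ d, maskT H₁ d)` have the same size** (the product of the tag-table fibre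
and the mask-table fibre). [folklore] -/
theorem card_fibre_tables (h : labelLen d ≤ μ) (q : TagTable d μ × MaskTable d μ) :
    (Finset.univ.filter fun Hn : PrfTable μ × PrfTable μ => (tagT Hn.1 d, maskT Hn.2 d) = q).card =
      Fintype.card (Fin μ → Bool) ^ (Fintype.card (Fin μ → Bool) - Fintype.card (Fin (labelLen d) → Bool)) *
        (Fintype.card Bool ^ (Fintype.card (Fin μ) - Fintype.card (Fin (labelLen d)))) ^
          Fintype.card (Fin μ → Bool) := by
  classical
  rw [← card_fibre_tagT h q.1, ← card_fibre_maskT h q.2, ← Fintype.card_prod, ← Fintype.card_subtype]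
  exact Fintype.card_congr ((Equiv.subtypeEquivRight fun Hn => Prod.ext_iff).trans
    (Equiv.subtypeProdEquivProd (p := fun H₀ : PrfTable μ => tagT H₀ d = q.1)
      (q := fun H₁ : PrfTable μ => maskT H₁ d = q.2)))

/-! ## Counting through a map with fibres of one size -/

/-- Through a map all of whose fibres have the same size `n`, every event of the codomain is counted `n` times
(sum over the fibres). [folklore] -/
theorem card_filter_comp_of_fibre {α β : Type*} [Fintype α] [Fintype β] [DecidableEq β] (f : α → β) {n : ℕ}
    (hn : ∀ b, (Finset.univ.filter fun a => f a = b).card = n) (E : β → Prop) [DecidablePred E] :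
    (Finset.univ.filter fun a => E (f a)).card = (Finset.univ.filter E).card * n := by
  have hmaps : Set.MapsTo f ↑(Finset.univ.filter fun a => E (f a)) ↑(Finset.univ.filter E) := fun a ha =>
    Finset.mem_coe.2 (Finset.mem_filter.2 ⟨Finset.mem_univ _, (Finset.mem_filter.1 (Finset.mem_coe.1 ha)).2⟩)
  rw [Finset.card_eq_sum_card_fiberwise hmaps]
  refine Finset.sum_const_nat fun b hb => ?_
  rw [Finset.mem_filter] at hb
  rw [← hn b]
  congr 1
  ext a
  simp only [Finset.mem_filter, Finset.mem_univ, true_and]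
  exact ⟨fun h => h.2, fun h => ⟨h ▸ hb.2, h⟩⟩

/-- A map all of whose fibres have the same size `n` has a domain `n` times the size of its codomain. [folklore] -/
theorem card_eq_of_fibre {α β : Type*} [Fintype α] [Fintype β] [DecidableEq β] (f : α → β) {n : ℕ}
    (hn : ∀ b, (Finset.univ.filter fun a => f a = b).card = n) :
    Fintype.card α = Fintype.card β * n := by
  have hmaps : Set.MapsTo f ↑(Finset.univ : Finset α) ↑(Finset.univ : Finset β) := fun a _ =>
    Finset.mem_coe.2 (Finset.mem_univ (f a))
  rw [← Finset.card_univ, ← Finset.card_univ, Finset.card_eq_sum_card_fiberwise hmaps]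
  exact Finset.sum_const_nat fun b _ => hn b

/-! ## The registered stub -/

/-- **Stub `stub_namingCode`** (the naming layer of ideal model II is EXACTLY ideal): (i) the code naming over the
table scheme is the ideal SIV naming of the tag table of the first and the mask table of the second naming table
(stage 5's `stub_namingTables` at the table scheme, plus `prf_tabScheme`); (ii) for `2d + 3 ≤ μ` the map
`(H₀, H₁) ↦ (tagT H₀ d, maskT H₁ d)` has all fibres of the same size (restriction along the injective zero-padding
of labels; post-composition with a coordinate truncation), so events of the tables are counted proportionally
(cross-multiplied, no division). [folklore] -/
theorem stub_namingCode :
    (∀ (μ d : ℕ) (H : CodeSpace μ), codeNaming H d = sivNaming (tagT H.1.1 d) (maskT H.1.2 d)) ∧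
    (∀ (μ d : ℕ), labelLen d ≤ μ → ∀ (E : TagTable d μ × MaskTable d μ → Prop) [DecidablePred E],
      (Finset.univ.filter fun Hn : PrfTable μ × PrfTable μ => E (tagT Hn.1 d, maskT Hn.2 d)).card *
          Fintype.card (TagTable d μ × MaskTable d μ) =
        (Finset.univ.filter E).card * Fintype.card (PrfTable μ × PrfTable μ)) := by
  refine ⟨fun μ d H => codeNaming_eq_sivNaming H d, fun μ d h E _ => ?_⟩
  have hn := card_fibre_tables (μ := μ) h
  rw [card_filter_comp_of_fibre (fun Hn : PrfTable μ × PrfTable μ => (tagT Hn.1 d, maskT Hn.2 d)) hn E,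
    card_eq_of_fibre (fun Hn : PrfTable μ × PrfTable μ => (tagT Hn.1 d, maskT Hn.2 d)) hn]
  ring

end Summit.QuantumAdvantage.QuantumAdvantage.Theorems.WbwObfuscatedGluedTrees.KnowledgeOfWalk.RealIdeal
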